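import Summits.NavierStokesRegularity.NavierStokesRegularity.Theorems.ExtremiserTransienceNearExtremalTransienceExtremiserLiouvilleConstantSpeedExampleGradientTools
import Summits.NavierStokesRegularity.NavierStokesRegularity.Theorems.ExtremiserTransienceNearExtremalTransienceExtremiserLiouvilleConstantSpeedExampleFarField
import Mathlib.Analysis.SpecialFunctions.JapaneseBracket
import HarnessLib

/-!
# Crux `ExtremiserTransience.NearExtremalTransience` (stmt-NavierStokesRegularity-21883), line `extremiser_liouville`,
# stub K1b — THE EXPLICIT CONSTANT-SPEED FIELD (3/3): bounded gradient and finite Dirichlet energy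

`--supports stmt-NavierStokesRegularity-21883` (helper).  Author: prover seat `ns-el-k1b` (g4).  Sequel of
`…ConstantSpeedExample` (`v = fc·(x₀,x₁,0) + gc·(−x₁,x₀,0) + (1 + hc)·e₃`, `‖v‖ ≡ 1`, `div v = 0`, real analytic, not
constant).

MAIN RESULTS.  `norm_fderiv_field_le`: **`‖Dv(x)‖ ≤ 74/Q(x)`**, `Q = ‖x‖² + 1` (the sharp constant is `2`, numerically);
hence `exists_bound_fderiv_field` (**bounded gradient**, `‖Dv‖ ≤ 74`) and `lintegral_iteratedFDeriv_one_lt_top`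
(**finite Dirichlet energy** `∫⁻ ‖D¹v‖ₑ² < ∞`, since `Q⁻² = (1 + ‖x‖²)⁻²` is integrable on `ℝ³`).  So the example sits in
the «extended admissible class» of K1b (`ContDiff ⊤`, divergence free, `‖fderiv‖ ≤ B`, `D¹ ∈ L²`; `D² ∈ L²` also holds —
`‖D²v‖ ≤ 4.3/Q` numerically — but is not formalised) with constant speed and a far field, yet it is not constant: the
soft part of the residue class is non-empty in the precise function class of the stub —
`exists_admissible_constantSpeed_nonconstant` packages this in the vocabulary of `stub_noAnalyticExtremal`.

METHOD.  `Dv = fc·Dhz + Dfc ⊗ (x₀,x₁,0) + gc·J + Dgc ⊗ Jx + Dhc ⊗ e₃` (`hasFDerivAt_field`), `‖(x₀,x₁,0)‖ = ‖Jx‖ = √u`,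
and the elementary bounds `|fc| ≤ 1/Q`, `|gc| ≤ 2/Q`, `‖Dfc‖·√u ≤ 9/Q`, `‖Dgc‖·√u ≤ 53/Q`, `‖Dhc‖ ≤ 8/Q` (polynomial
inequalities in `u, b, Q = u + b ≥ 1`, `x₂² ≤ b`, `xᵢ² ≤ u`, `N ∈ [(3/2)bQ³, 2Q⁴]`; square roots are removed by
comparing squares).

WHAT THIS IS NOT: not a counterexample to K1b; K1b is NOT proved; nothing here proves NS regularity. [folklore]
-/

noncomputable section

open Set Filter Topology MeasureTheory Metric Function
open scoped ENNReal NNReal Topology InnerProductSpace RealInnerProductSpace ContDiff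
open Literature.Analysis.FluidPDE Literature.Analysis

namespace Summit.NavierStokesRegularity.NavierStokesRegularity.Theorems

-- the problem directory repeats the summit name (`NavierStokesRegularity/NavierStokesRegularity`)
set_option linter.dupNamespace false

namespace ExtremiserLiouville

namespace ConstantSpeedExample

/-! ## The swirl coefficient: `‖D gc‖·√u ≤ 53/Q` -/

/-- `‖D gc‖·√u ≤ 53/Q`. [folklore] -/
theorem norm_fderiv_gc_mul_sqrt_le (x : EuclideanSpace ℝ (Fin 3)) :
    ‖fderiv ℝ gc x‖ * Real.sqrt (uu x) ≤ 53 / QQ x := by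
  have hQ := QQ_pos x
  have hQ1 := one_le_QQ x
  have hu := uu_nonneg x
  have hb := (bb_pos x).le
  have hb1 := one_le_bb x
  have hsu0 := Real.sqrt_nonneg (uu x)
  have hsN0 : 0 < Real.sqrt (NN x) := Real.sqrt_pos.mpr (NN_pos x)
  have hsN := sqrt_NN_le x
  have hNge := NN_ge x
  have huQ := uu_le_QQ x
  have hbQ := bb_le_QQ x
  have hub := uu_mul_bb_le x
  have hx2b : x 2 ^ 2 ≤ bb x := by simp only [bb]; linarith
  -- `|xⱼ| √u ≤ Q` for every `j`
  have hxs : ∀ j : Fin 3, |x j| * Real.sqrt (uu x) ≤ QQ x := by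
    intro j
    fin_cases j
    · exact (abs_coord_mul_sqrt_uu_le x (i := 0) (Or.inl rfl)).trans huQ
    · exact (abs_coord_mul_sqrt_uu_le x (i := 1) (Or.inr rfl)).trans huQ
    · have := abs_x2_mul_sqrt_uu_le x; simp only [Fin.reduceFinMk] at this ⊢; linarith
  -- second parts: `|6 xⱼ √N / Q⁴| √u ≤ 12/Q`
  have T2 : ∀ j : Fin 3, |6 * x j * Real.sqrt (NN x) / QQ x ^ 4| * Real.sqrt (uu x) ≤ 12 / QQ x := by
    intro j
    rw [abs_div, abs_of_pos (pow_pos hQ 4), div_mul_eq_mul_div, div_le_div_iff₀ (pow_pos hQ 4) hQ, abs_mul,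
      abs_mul, abs_of_pos hsN0, show |(6 : ℝ)| = 6 by norm_num]
    have : 6 * |x j| * Real.sqrt (NN x) * Real.sqrt (uu x) = 6 * (|x j| * Real.sqrt (uu x)) * Real.sqrt (NN x) := by
      ring
    rw [this]
    have h := hxs j
    have : 6 * (|x j| * Real.sqrt (uu x)) * Real.sqrt (NN x) ≤ 6 * QQ x * (2 * QQ x ^ 2) := by gcongr
    nlinarith [pow_pos hQ 3]
  -- first parts, `j = 0, 1`: `|x_j B| √u /(2√N Q³) ≤ 4/Q`, `B = 12bQ² − 2b² − 4u x₂²`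
  have hB : |12 * bb x * QQ x ^ 2 - 2 * bb x ^ 2 - 4 * uu x * x 2 ^ 2| ≤ 18 * bb x * QQ x ^ 2 := by
    rw [abs_le]; constructor <;> nlinarith [mul_nonneg hu (sq_nonneg (x 2)), mul_le_mul_of_nonneg_left hx2b hu,
      mul_le_mul hbQ hQ1 zero_le_one hQ.le, pow_pos hQ 2, mul_nonneg hb hQ.le]
  have h9 : 9 * uu x * bb x ≤ 4 * Real.sqrt (NN x) := by
    have hsq : (9 * uu x * bb x / 4) ^ 2 ≤ NN x := by
      have : uu x ^ 2 * bb x ^ 2 ≤ bb x * QQ x ^ 3 / 4 := by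
        have e : uu x ^ 2 * bb x ^ 2 = (uu x * bb x) * (uu x * bb x) := by ring
        rw [e]
        calc (uu x * bb x) * (uu x * bb x) ≤ (QQ x ^ 2 / 4) * (QQ x * bb x) := by
              apply mul_le_mul hub (mul_le_mul_of_nonneg_right huQ hb) (by positivity) (by positivity)
          _ = bb x * QQ x ^ 3 / 4 := by ring
      nlinarith
    have := Real.sqrt_le_sqrt hsq
    rw [Real.sqrt_sq (by positivity)] at this
    linarith
  have T1 : ∀ i : Fin 3, i = 0 ∨ i = 1 →
      |x i * (12 * bb x * QQ x ^ 2 - 2 * bb x ^ 2 - 4 * uu x * x 2 ^ 2) / (2 * Real.sqrt (NN x) * QQ x ^ 3)| *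
        Real.sqrt (uu x) ≤ 4 / QQ x := by
    intro i hi
    have hden : 0 < 2 * Real.sqrt (NN x) * QQ x ^ 3 := by positivity
    rw [abs_div, abs_of_pos hden, div_mul_eq_mul_div, div_le_div_iff₀ hden hQ, abs_mul]
    have hxi := abs_coord_mul_sqrt_uu_le x hi
    have e : |x i| * |12 * bb x * QQ x ^ 2 - 2 * bb x ^ 2 - 4 * uu x * x 2 ^ 2| * Real.sqrt (uu x) * QQ x =
        (|x i| * Real.sqrt (uu x)) * |12 * bb x * QQ x ^ 2 - 2 * bb x ^ 2 - 4 * uu x * x 2 ^ 2| * QQ x := by ring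
    rw [e]
    have : (|x i| * Real.sqrt (uu x)) * |12 * bb x * QQ x ^ 2 - 2 * bb x ^ 2 - 4 * uu x * x 2 ^ 2| * QQ x ≤
        uu x * (18 * bb x * QQ x ^ 2) * QQ x := by gcongr
    nlinarith [pow_pos hQ 3, mul_le_mul_of_nonneg_right h9 (pow_pos hQ 3).le]
  -- first part, `j = 2`: `|x₂ B₂| √u /(2√N Q³) ≤ 9/Q`, `B₂ = 4Q³ + 12bQ² − 4ub − 2u²`
  have hB2 : |4 * QQ x ^ 3 + 12 * bb x * QQ x ^ 2 - 4 * uu x * bb x - 2 * uu x ^ 2| ≤ 22 * QQ x ^ 3 := by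
    rw [abs_le]; constructor <;> nlinarith [mul_nonneg hu hb, sq_nonneg (uu x), pow_pos hQ 2, pow_pos hQ 3,
      mul_le_mul hbQ (le_refl (QQ x ^ 2)) (by positivity) hQ.le, mul_le_mul huQ huQ hu hQ.le]
  have h11 : 11 * (|x 2| * Real.sqrt (uu x)) * QQ x ≤ 9 * Real.sqrt (NN x) := by
    have hsq : (11 * (|x 2| * Real.sqrt (uu x)) * QQ x / 9) ^ 2 ≤ NN x := by
      have e : (11 * (|x 2| * Real.sqrt (uu x)) * QQ x / 9) ^ 2 = (121 / 81) * (x 2 ^ 2 * uu x * QQ x ^ 2) := by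
        rw [div_pow, mul_pow, mul_pow, mul_pow, sq_abs, Real.sq_sqrt hu]; ring
      rw [e]
      have : x 2 ^ 2 * uu x * QQ x ^ 2 ≤ bb x * QQ x ^ 3 := by
        calc x 2 ^ 2 * uu x * QQ x ^ 2 ≤ bb x * QQ x * QQ x ^ 2 := by gcongr
          _ = bb x * QQ x ^ 3 := by ring
      nlinarith [mul_nonneg hb (pow_pos hQ 3).le]
    have := Real.sqrt_le_sqrt hsq
    rw [Real.sqrt_sq (by positivity)] at this
    linarith
  have T1c : |x 2 * (4 * QQ x ^ 3 + 12 * bb x * QQ x ^ 2 - 4 * uu x * bb x - 2 * uu x ^ 2) /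
      (2 * Real.sqrt (NN x) * QQ x ^ 3)| * Real.sqrt (uu x) ≤ 9 / QQ x := by
    have hden : 0 < 2 * Real.sqrt (NN x) * QQ x ^ 3 := by positivity
    rw [abs_div, abs_of_pos hden, div_mul_eq_mul_div, div_le_div_iff₀ hden hQ, abs_mul]
    have e : |x 2| * |4 * QQ x ^ 3 + 12 * bb x * QQ x ^ 2 - 4 * uu x * bb x - 2 * uu x ^ 2| * Real.sqrt (uu x) * QQ x =
        (|x 2| * Real.sqrt (uu x)) * QQ x * |4 * QQ x ^ 3 + 12 * bb x * QQ x ^ 2 - 4 * uu x * bb x - 2 * uu x ^ 2| := by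
      ring
    rw [e]
    have h0 : 0 ≤ (|x 2| * Real.sqrt (uu x)) * QQ x := by positivity
    have : (|x 2| * Real.sqrt (uu x)) * QQ x * |4 * QQ x ^ 3 + 12 * bb x * QQ x ^ 2 - 4 * uu x * bb x - 2 * uu x ^ 2|
        ≤ (|x 2| * Real.sqrt (uu x)) * QQ x * (22 * QQ x ^ 3) := mul_le_mul_of_nonneg_left hB2 h0
    nlinarith [mul_le_mul_of_nonneg_right h11 (pow_pos hQ 3).le]
  -- assemble
  rw [(hasFDerivAt_gc x).fderiv]
  refine (mul_le_mul_of_nonneg_right (norm_combo_le _ _ _) hsu0).trans ?_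
  have tri : ∀ (p q : ℝ), |p - q| * Real.sqrt (uu x) ≤ |p| * Real.sqrt (uu x) + |q| * Real.sqrt (uu x) :=
    fun p q => by rw [← add_mul]; exact mul_le_mul_of_nonneg_right (abs_sub p q) hsu0
  have G0 := (tri _ _).trans (add_le_add (T1 0 (Or.inl rfl)) (T2 0))
  have G1 := (tri _ _).trans (add_le_add (T1 1 (Or.inr rfl)) (T2 1))
  have G2 := (tri _ _).trans (add_le_add T1c (T2 2))
  have e53 : (53 : ℝ) / QQ x = (4 / QQ x + 12 / QQ x) + (4 / QQ x + 12 / QQ x) + (9 / QQ x + 12 / QQ x) := by ring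
  rw [add_mul, add_mul, e53]
  exact add_le_add (add_le_add G0 G1) G2

/-! ## Main results -/

/-- **`‖Dv(x)‖ ≤ 74/Q(x)`**, `Q = ‖x‖² + 1`. [folklore] -/
theorem norm_fderiv_field_le (x : EuclideanSpace ℝ (Fin 3)) : ‖fderiv ℝ field x‖ ≤ 74 / QQ x := by
  have hQ := QQ_pos x
  have hsu0 := Real.sqrt_nonneg (uu x)
  rw [(hasFDerivAt_field x).fderiv]
  have n1 : ‖fc x • (ContinuousLinearMap.id ℝ (EuclideanSpace ℝ (Fin 3)) -
      (EuclideanSpace.proj (2 : Fin 3) : EuclideanSpace ℝ (Fin 3) →L[ℝ] ℝ).smulRight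
        (EuclideanSpace.single (2 : Fin 3) (1 : ℝ)))‖ ≤ 2 / QQ x := by
    rw [norm_smul, Real.norm_eq_abs]
    have := mul_le_mul (abs_fc_le x) norm_hzL_le (norm_nonneg _) (by positivity)
    have e : 1 / QQ x * 2 = 2 / QQ x := by ring
    linarith [this]
  have n2 : ‖(fderiv ℝ fc x).smulRight (hz x)‖ ≤ 9 / QQ x := by
    rw [ContinuousLinearMap.norm_smulRight_apply, norm_hz]; exact norm_fderiv_fc_mul_sqrt_le x
  have n3 : ‖gc x • (rotGenL : EuclideanSpace ℝ (Fin 3) →L[ℝ] EuclideanSpace ℝ (Fin 3))‖ ≤ 2 / QQ x := by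
    rw [norm_smul, Real.norm_eq_abs]
    have := mul_le_mul (abs_gc_le x) norm_rotGenL_le_one (norm_nonneg _) (by positivity)
    have e : 2 / QQ x * 1 = 2 / QQ x := by ring
    linarith [this]
  have n4 : ‖(fderiv ℝ gc x).smulRight (rotGen x)‖ ≤ 53 / QQ x := by
    rw [ContinuousLinearMap.norm_smulRight_apply, norm_rotGen_eq]; exact norm_fderiv_gc_mul_sqrt_le x
  have n5 : ‖(fderiv ℝ hc x).smulRight (EuclideanSpace.single (2 : Fin 3) (1 : ℝ))‖ ≤ 8 / QQ x := by
    rw [ContinuousLinearMap.norm_smulRight_apply]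
    simp only [PiLp.norm_single, norm_one, mul_one]
    exact norm_fderiv_hc_le x
  have e74 : (74 : ℝ) / QQ x = 2 / QQ x + 9 / QQ x + (2 / QQ x + 53 / QQ x) + 8 / QQ x := by ring
  rw [e74]
  exact (norm_add_le _ _).trans (add_le_add ((norm_add_le _ _).trans (add_le_add ((norm_add_le _ _).trans
    (add_le_add n1 n2)) ((norm_add_le _ _).trans (add_le_add n3 n4)))) n5)

/-- **Bounded gradient**: `‖Dv‖ ≤ 74`. [folklore] -/
theorem exists_bound_fderiv_field : ∃ B : ℝ, ∀ x, ‖fderiv ℝ field x‖ ≤ B :=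
  ⟨74, fun x => (norm_fderiv_field_le x).trans (div_le_self (by norm_num) (one_le_QQ x))⟩

/-- **Finite Dirichlet energy**: `∫⁻ ‖D¹v‖ₑ² < ∞` (`‖Dv‖² ≤ 74²/Q² = 74²(1 + ‖x‖²)⁻²`, integrable on `ℝ³`). [folklore] -/
theorem lintegral_iteratedFDeriv_one_lt_top : ∫⁻ x, ‖iteratedFDeriv ℝ 1 field x‖ₑ ^ 2 < ⊤ := by
  have hint : Integrable (fun x : EuclideanSpace ℝ (Fin 3) => (74 : ℝ) ^ 2 * ((1 : ℝ) + ‖x‖ ^ 2) ^ (-(4 : ℝ) / 2))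
      volume := by
    refine (integrable_rpow_neg_one_add_norm_sq ?_).const_mul _
    simp [finrank_euclideanSpace]; norm_num
  refine lt_of_le_of_lt (lintegral_mono fun x => ?_) hint.lintegral_lt_top
  have hQ := QQ_pos x
  have hb := norm_fderiv_field_le x
  have h0 : 0 ≤ ‖fderiv ℝ field x‖ := norm_nonneg _
  rw [← ofReal_norm, norm_iteratedFDeriv_one, ← ENNReal.ofReal_pow (norm_nonneg _)]
  refine ENNReal.ofReal_le_ofReal ?_
  have e : ((1 : ℝ) + ‖x‖ ^ 2) ^ (-(4 : ℝ) / 2) = (QQ x ^ 2)⁻¹ := by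
    rw [QQ_eq_norm_sq_add_one, show (-(4 : ℝ) / 2) = -(2 : ℝ) by norm_num, Real.rpow_neg (by positivity),
      add_comm]
    norm_num
  rw [e]
  have : ‖fderiv ℝ field x‖ ^ 2 ≤ (74 / QQ x) ^ 2 := pow_le_pow_left₀ h0 hb 2
  calc ‖fderiv ℝ field x‖ ^ 2 ≤ (74 / QQ x) ^ 2 := this
    _ = 74 ^ 2 * (QQ x ^ 2)⁻¹ := by rw [div_pow]; ring

/-- **PACKAGED (vocabulary of K1b).**  There is `w : ℝ³ → ℝ³` with ALL the structural hypotheses of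
`stub_noAnalyticExtremal` (real analytic, `C^∞`, divergence free, bounded gradient, `D¹w ∈ L²`) EXCEPT `D²w ∈ L²`
(true, not formalised) and the efficiency inequality, which moreover has CONSTANT SPEED `‖w‖ ≡ 1` and far field `e₃`,
and yet is NOT constant (and `‖w − e₃‖² ∉ L¹`).  The K1b residue «no constant-speed analytic extended extremiser»
therefore cannot be closed without the extremality. [folklore] -/
theorem exists_admissible_constantSpeed_nonconstant :
    ∃ w : EuclideanSpace ℝ (Fin 3) → EuclideanSpace ℝ (Fin 3), AnalyticOnNhd ℝ w univ ∧ ContDiff ℝ (⊤ : ℕ∞) w ∧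
      VectorCalculus.IsDivFree w ∧ (∃ B : ℝ, ∀ x, ‖fderiv ℝ w x‖ ≤ B) ∧
      (∫⁻ x, ‖iteratedFDeriv ℝ 1 w x‖ₑ ^ 2 < ⊤) ∧ (∀ x, ‖w x‖ = 1) ∧
      Tendsto w (cocompact (EuclideanSpace ℝ (Fin 3))) (𝓝 (EuclideanSpace.single (2 : Fin 3) (1 : ℝ))) ∧
      (¬ ∀ x, w x = EuclideanSpace.single (2 : Fin 3) (1 : ℝ)) ∧
      ¬ Integrable (fun x => ‖w x - EuclideanSpace.single (2 : Fin 3) (1 : ℝ)‖ ^ 2) volume :=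
  ⟨field, analyticOnNhd_field, contDiff_field, isDivFree_field, exists_bound_fderiv_field,
    lintegral_iteratedFDeriv_one_lt_top, norm_field, tendsto_field_cocompact, field_ne_const,
    not_integrable_norm_sub_sq⟩

end ConstantSpeedExample

end ExtremiserLiouville

end Summit.NavierStokesRegularity.NavierStokesRegularity.Theorems

end
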